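import Summits.CriticalPhenomena.SAWScalingLimit.Theorems.SAWDevelopingMapHexTransferThirdBdryEndpoints
import HarnessLib

/-!
# `ThirdEndpoints` (line `birth` = the Yang–Baxter relay, crux `LatticeUniversality`,
# stmt-CriticalPhenomena-0807)

Stub `stub_thirdEndpoints` of the line `birth` for the crux
`Summit.CriticalPhenomena.SAWScalingLimit.Theses.SAWMassiveIsingTilt.LatticeUniversality`
(stmt-CriticalPhenomena-0807; lattice universality of the critical chordal SAW law, relayed
hexagonal SAW → Glazman–Manolescu walk on the rhombic tiling `H(π/3)` → GM walk on `H(π/2)` →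
uniform `δℤ²` SAW): **every Dobrushin domain `D = (Ω; a, b)` admits mid-edge endpoint
approximations on Glazman–Manolescu's hexagonal point `Θ ≡ π/3`** — mid-edges `a_δ, b_δ` joined
by a Yang–Baxter walk of `Ω_δ = meshFaces (π/3) Ω δ` for all small `δ > 0`, with `δ a_δ → a`,
`δ b_δ → b` (`IsYBEndpointApprox (fun _ => π/3) D a_δ b_δ`). In other words the endpoint
hypothesis of the Yang–Baxter convergence statements at the hexagonal point is never vacuous.

Source: this is the case `α = π/3` of the landed all-angle statement
`Cruxes.HexTransfer.YbRelay.ybEndpoints_of_mem_Icc` (every constant angle `α ∈ [π/3, 2π/3]`,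
file `Theorems/SAWDevelopingMapHexTransferThirdBdryEndpoints`), itself the boundary-free part of
`ybBdryEndpoints` (interior points `z_n → a`, `w_n → b`, a chain of `δ`-rhombi of `Ω_δ` joining
their faces, a side of the skew-`ℓ¹`-closest face bordering no other face of `Ω_δ`, diagonal stage
selection). Proof idea here: `π/3 ∈ [π/3, 2π/3]` since `0 < π`.
-/

noncomputable section

namespace Summit.CriticalPhenomena.SAWScalingLimit.Cruxes.LatticeUniversality.Birth

open Literature.Probability.RandomPlanarGeometry
open Literature.Probability.RandomPlanarGeometry.SAW.YangBaxter

/-- **Stub `stub_thirdEndpoints`** (line `birth`, crux `LatticeUniversality`,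
stmt-CriticalPhenomena-0807): every Dobrushin domain admits mid-edge endpoint approximations on
Glazman–Manolescu's hexagonal point `Θ ≡ π/3` — for all small `δ > 0` a Yang–Baxter walk of
`meshFaces (π/3) Ω δ` joins `a_δ` to `b_δ`, and `δ a_δ → a`, `δ b_δ → b`. The case `α = π/3` of
`Cruxes.HexTransfer.YbRelay.ybEndpoints_of_mem_Icc` (the skeleton's `ThirdEndpoints`, unfolded).
[folklore] -/
theorem stub_thirdEndpoints : ∀ D : DobrushinDomain, ∃ a b : ℝ → MidEdge, IsYBEndpointApprox (fun (_ : ℤ) => Real.pi / 3) D a b := fun D =>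
  Cruxes.HexTransfer.YbRelay.ybEndpoints_of_mem_Icc (Real.pi / 3)
    ⟨le_rfl, by linarith [Real.pi_pos]⟩ D

end Summit.CriticalPhenomena.SAWScalingLimit.Cruxes.LatticeUniversality.Birth
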